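import Summits.AtomisticToContinuum.FouriersLaw.Theses.ContactStieltjesMeasure

/-!
# Line `frictiongrid` (strategist, alternative to `birth`) for crux `ContactUpperDensity`
— route `ContactStieltjesMeasure`, item stmt-AtomisticToContinuum-15249, sub-problem `FouriersLaw`.

The crux (U): for every family `Φ_N` of contact distribution functions representing the linear
response at every friction `γ` (hypothesis HΦ = the data of K2), eventually in `N`,
`N·Φ_N(t) ≤ C·(1+t)` for all `t > 0`.

CUT OF THIS LINE (conductance currency, dyadic friction grid). The representing property makes
`D_N(γ) := (N-1)·γ·∫₀^∞ Φ_N w_γ`, `w_γ(t) = 2t/(γ²+t²)²`, the finite-`N` RESPONSE COEFFICIENT of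
`pinnedChain ω₂ lam β γ` (an honest NESS quantity: `lim_{δ→0} totalCurrent/δ`). The proved
SANDWICH `Φ_N(γ) ≤ 2γ·(γ∫Φ_N w_γ)` (layer cake: keep only `t > γ`, where `Φ_N(t) ≥ Φ_N(γ)` and
`∫_γ^∞ w_γ = 1/(2γ²)`) turns a bound on `D_N(γ)` into a bound on the contact distribution function
AT THE SCALE `t = γ`; monotonicity of `Φ_N` interpolates between consecutive dyadic frictions at the
cost of a factor `2`. Hence (U) follows from

* `stub_dyadicFrictionResponse` — BOUNDED RESPONSE, UNIFORM ON THE DYADIC FRICTION GRID INSIDE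
  `[1, N]`: `∃ C' N₀, ∀ N ≥ N₀, ∀ k, 2^k ≤ N → D_N(2^k) ≤ C'`. At each FIXED `k` this is exactly the
  shared bounded-response item (`FeketeSeriesLaw.BoundedResponse`, stmt-AtomisticToContinuum-11071)
  at friction `γ = 2^k` — PROVED below (`gridPointwise_of_boundedResponse`); the content of the stub
  is the UNIFORMITY of the constant along `γ = 1, 2, 4, …, ≤ N` ('no friction-tuned
  superconductance': the two-terminal resistance of the `N`-chain is `≥ (N-1)/C'` at every dyadic
  bath coupling up to `N`). Countably many frictions per `N`, a statement about NESS currents.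
* `stub_uvUniformMass` — the total contact mass `Φ_N(∞) = lim_γ γ·G_N(γ)` is bounded uniformly in
  `N` (the `CouplingFreeCeiling` technology, support item stmt-AtomisticToContinuum-15180); it
  carries every scale `t ≥ N/2`. (Same statement as line `birth`'s UV stub: one proof serves both.)

`assembly_of_stubs` (sorry-free) derives the crux body; `ContactUpperDensity_of` concludes the crux
BY NAME. Sorries live ONLY in the two `stub_*` theorems. The companion workfile
`FrictionGridTransfer.lean` (sorry-free, same crux directory) proves
`gridPointwise_of_boundedResponse`: the grid stub at each FIXED friction is the shared item 11071
(hypothesis written out verbatim, no extra import).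
-/

namespace Summit.AtomisticToContinuum.FouriersLaw.Cruxes.ContactUpperDensity.FrictionGrid

open MeasureTheory Filter Set
open scoped Topology

/-! ## Real analysis of the contact weight `w_γ(t) = 2t/(γ²+t²)²` (proved) -/

/-- `-(γ²+t²)⁻¹` is an antiderivative of the contact weight `w_γ(t) = 2t/(γ²+t²)²`. -/
theorem hasDerivAt_negInvQuad (γ t : ℝ) (h : γ ^ 2 + t ^ 2 ≠ 0) :
    HasDerivAt (fun s : ℝ => -(γ ^ 2 + s ^ 2)⁻¹) (2 * t / (γ ^ 2 + t ^ 2) ^ 2) t := by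
  have h1 : HasDerivAt (fun s : ℝ => γ ^ 2 + s ^ 2) (2 * t) t :=
    ((hasDerivAt_pow 2 t).const_add (γ ^ 2)).congr_deriv (by norm_num)
  have h2 : HasDerivAt (-(fun s : ℝ => γ ^ 2 + s ^ 2)⁻¹) (2 * t / (γ ^ 2 + t ^ 2) ^ 2) t :=
    ((h1.inv h).neg).congr_deriv (by ring)
  exact h2

/-- The antiderivative tends to `0` at `+∞`. -/
theorem tendsto_negInvQuad (γ : ℝ) : Tendsto (fun s : ℝ => -(γ ^ 2 + s ^ 2)⁻¹) atTop (𝓝 0) := by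
  have h1 : Tendsto (fun s : ℝ => γ ^ 2 + s ^ 2) atTop atTop :=
    tendsto_atTop_add_const_left _ _ (tendsto_pow_atTop two_ne_zero)
  have h2 := (tendsto_inv_atTop_zero.comp h1).neg
  simpa [Function.comp_def] using h2

/-- The contact weight is nonnegative on `[0, ∞)`. -/
theorem weight_nonneg {γ t : ℝ} (ht : 0 ≤ t) : 0 ≤ 2 * t / (γ ^ 2 + t ^ 2) ^ 2 := by
  positivity

/-- `∫_a^∞ w_γ = 1/(γ² + a²)` for `γ > 0`, `a ≥ 0`. -/
theorem integral_weight_Ioi {γ a : ℝ} (hγ : 0 < γ) (ha : 0 ≤ a) :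
    ∫ t in Ioi a, 2 * t / (γ ^ 2 + t ^ 2) ^ 2 = (γ ^ 2 + a ^ 2)⁻¹ := by
  have hne : ∀ t : ℝ, γ ^ 2 + t ^ 2 ≠ 0 := fun t => by positivity
  have h := integral_Ioi_of_hasDerivAt_of_nonneg' (fun t _ => hasDerivAt_negInvQuad γ t (hne t))
    (fun t ht => weight_nonneg (ha.trans (Set.mem_Ioi.1 ht).le)) (tendsto_negInvQuad γ)
  rw [h]
  ring

/-- The contact weight is integrable on `(a, ∞)`, `a ≥ 0`. -/
theorem integrableOn_weight_Ioi {γ a : ℝ} (hγ : 0 < γ) (ha : 0 ≤ a) :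
    IntegrableOn (fun t : ℝ => 2 * t / (γ ^ 2 + t ^ 2) ^ 2) (Ioi a) := by
  have hne : ∀ t : ℝ, γ ^ 2 + t ^ 2 ≠ 0 := fun t => by positivity
  exact integrableOn_Ioi_deriv_of_nonneg' (fun t _ => hasDerivAt_negInvQuad γ t (hne t))
    (fun t ht => weight_nonneg (ha.trans (Set.mem_Ioi.1 ht).le)) (tendsto_negInvQuad γ)

/-! ## The contact–conductance sandwich (proved): `Φ(γ) ≤ 2γ · G(γ)`, `G(γ) := γ∫₀^∞ Φ w_γ` -/

/-- SANDWICH (layer-cake lower bound). For a monotone `φ` vanishing on `(-∞, 0]` and bounded,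
and `γ > 0`: `φ(γ) ≤ 2γ·(γ·∫₀^∞ φ(t)·2t/(γ²+t²)² dt)` — keep only `t > γ`, where
`φ(t) ≥ φ(γ)`, and use `∫_γ^∞ 2t/(γ²+t²)² dt = 1/(2γ²)`. In contact currency: the contact
distribution function at scale `γ` is at most `2γ` times the conductance at friction `γ`. -/
theorem sandwich {φ : ℝ → ℝ} (hmono : Monotone φ) (hzero : ∀ s : ℝ, s ≤ 0 → φ s = 0)
    {m : ℝ} (hbdd : ∀ s : ℝ, φ s ≤ m) {γ : ℝ} (hγ : 0 < γ) :
    φ γ ≤ 2 * γ * (γ * ∫ t in Ioi (0 : ℝ), φ t * (2 * t / (γ ^ 2 + t ^ 2) ^ 2)) := by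
  have hφ0 : ∀ t : ℝ, 0 ≤ t → 0 ≤ φ t := fun t ht => by
    have h := hmono ht
    rwa [hzero 0 le_rfl] at h
  have hw0 : ∀ t : ℝ, 0 ≤ t → 0 ≤ 2 * t / (γ ^ 2 + t ^ 2) ^ 2 := fun t ht => weight_nonneg ht
  have hwint : IntegrableOn (fun t : ℝ => 2 * t / (γ ^ 2 + t ^ 2) ^ 2) (Ioi 0) :=
    integrableOn_weight_Ioi hγ le_rfl
  have hwc : Continuous fun t : ℝ => 2 * t / (γ ^ 2 + t ^ 2) ^ 2 := by
    refine Continuous.div (by fun_prop) (by fun_prop) fun t => ?_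
    positivity
  have hmeas : AEStronglyMeasurable (fun t : ℝ => φ t * (2 * t / (γ ^ 2 + t ^ 2) ^ 2))
      (volume.restrict (Ioi (0 : ℝ))) :=
    (hmono.measurable.mul hwc.measurable).aestronglyMeasurable
  have hint : IntegrableOn (fun t : ℝ => φ t * (2 * t / (γ ^ 2 + t ^ 2) ^ 2)) (Ioi 0) := by
    refine MeasureTheory.Integrable.mono' (MeasureTheory.Integrable.const_mul hwint m) hmeas ?_
    refine (ae_restrict_iff' measurableSet_Ioi).2 (Eventually.of_forall fun t ht => ?_)
    have ht' : 0 < t := Set.mem_Ioi.1 ht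
    rw [Real.norm_eq_abs, abs_of_nonneg (mul_nonneg (hφ0 t ht'.le) (hw0 t ht'.le))]
    exact mul_le_mul_of_nonneg_right (hbdd t) (hw0 t ht'.le)
  have hnn : 0 ≤ᵐ[volume.restrict (Ioi (0 : ℝ))] (fun t : ℝ => φ t * (2 * t / (γ ^ 2 + t ^ 2) ^ 2)) := by
    refine (ae_restrict_iff' measurableSet_Ioi).2 (Eventually.of_forall fun t ht => ?_)
    have ht' : 0 < t := Set.mem_Ioi.1 ht
    show (0 : ℝ) ≤ φ t * (2 * t / (γ ^ 2 + t ^ 2) ^ 2)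
    exact mul_nonneg (hφ0 t ht'.le) (hw0 t ht'.le)
  have I3 : ∫ t in Ioi γ, φ t * (2 * t / (γ ^ 2 + t ^ 2) ^ 2) ≤
      ∫ t in Ioi (0 : ℝ), φ t * (2 * t / (γ ^ 2 + t ^ 2) ^ 2) :=
    setIntegral_mono_set hint hnn (ae_of_all _ fun x hx => Ioi_subset_Ioi hγ.le hx)
  have hintγ : IntegrableOn (fun t : ℝ => φ t * (2 * t / (γ ^ 2 + t ^ 2) ^ 2)) (Ioi γ) :=
    hint.mono_set (Ioi_subset_Ioi hγ.le)
  have hwintγ : IntegrableOn (fun t : ℝ => 2 * t / (γ ^ 2 + t ^ 2) ^ 2) (Ioi γ) :=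
    integrableOn_weight_Ioi hγ hγ.le
  have I2 : ∫ t in Ioi γ, φ γ * (2 * t / (γ ^ 2 + t ^ 2) ^ 2) ≤
      ∫ t in Ioi γ, φ t * (2 * t / (γ ^ 2 + t ^ 2) ^ 2) :=
    setIntegral_mono_on (MeasureTheory.Integrable.const_mul hwintγ (φ γ)) hintγ measurableSet_Ioi
      fun t ht => mul_le_mul_of_nonneg_right (hmono (Set.mem_Ioi.1 ht).le)
        (hw0 t (hγ.le.trans (Set.mem_Ioi.1 ht).le))
  have I1 : ∫ t in Ioi γ, φ γ * (2 * t / (γ ^ 2 + t ^ 2) ^ 2) = φ γ * (γ ^ 2 + γ ^ 2)⁻¹ := by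
    rw [MeasureTheory.integral_const_mul, integral_weight_Ioi hγ hγ.le]
  have key : φ γ * (γ ^ 2 + γ ^ 2)⁻¹ ≤ ∫ t in Ioi (0 : ℝ), φ t * (2 * t / (γ ^ 2 + t ^ 2) ^ 2) :=
    I1 ▸ I2.trans I3
  have hne : γ ^ 2 + γ ^ 2 ≠ 0 := by positivity
  calc φ γ = 2 * γ * (γ * (φ γ * (γ ^ 2 + γ ^ 2)⁻¹)) := by field_simp; ring
    _ ≤ 2 * γ * (γ * ∫ t in Ioi (0 : ℝ), φ t * (2 * t / (γ ^ 2 + t ^ 2) ^ 2)) := by gcongr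

/-- Bookkeeping of one grid level (pure algebra): from `(N-1)·g·I ≤ A` (grid stub), `Φg ≤ 2g(gI)`
(sandwich), `N ≥ 2`, `g > 0`, `I ≥ 0` conclude `N·Φg ≤ 4A·g`. -/
theorem level_bound {Nr g I A Φg : ℝ} (hN : 2 ≤ Nr) (hg : 0 < g) (hI : 0 ≤ I)
    (hstub : (Nr - 1) * g * I ≤ A) (hsand : Φg ≤ 2 * g * (g * I)) : Nr * Φg ≤ 4 * A * g := by
  have h1 : Nr * Φg ≤ Nr * (2 * g * (g * I)) := mul_le_mul_of_nonneg_left hsand (by linarith)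
  have h2 : Nr * (g * I) ≤ 2 * ((Nr - 1) * g * I) := by
    nlinarith [mul_nonneg (sub_nonneg.2 hN) (mul_nonneg hg.le hI)]
  have h3 : 2 * g * (Nr * (g * I)) ≤ 2 * g * (2 * ((Nr - 1) * g * I)) :=
    mul_le_mul_of_nonneg_left h2 (by positivity)
  have h4 : 2 * g * (2 * ((Nr - 1) * g * I)) ≤ 2 * g * (2 * A) :=
    mul_le_mul_of_nonneg_left (by linarith) (by positivity)
  calc Nr * Φg ≤ Nr * (2 * g * (g * I)) := h1
    _ = 2 * g * (Nr * (g * I)) := by ring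
    _ ≤ 2 * g * (2 * ((Nr - 1) * g * I)) := h3
    _ ≤ 2 * g * (2 * A) := h4
    _ = 4 * A * g := by ring

/-! ## The two registered stubs -/

/-- stub 1 — BOUNDED RESPONSE, UNIFORM ON THE DYADIC FRICTION GRID (load-bearing, open): for every
representing family `Φ` (hypotheses of the crux, verbatim), `∃ C' N₀, ∀ N ≥ N₀, ∀ k, 2^k ≤ N →
(N-1)·2^k·∫₀^∞ Φ_N(t)·2t/((2^k)²+t²)² dt ≤ C'`, i.e. the response coefficient `D_N(2^k)` of
`pinnedChain ω₂ lam β (2^k)` is bounded uniformly in `N` AND along the frictions `1, 2, 4, …, ≤ N`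
(two-terminal resistance `≥ (N-1)/C'` at every dyadic coupling up to `N`). At FIXED `k` it is the
shared item `BoundedResponse` (stmt-AtomisticToContinuum-11071) at `γ = 2^k`
(`gridPointwise_of_boundedResponse` below); false at `lam = β = 0` (ballistic); implied by the crux
(paper converse `N·G_N(γ) ≤ C(1/γ + π/2)`), strictly weaker than it (says nothing beyond scale `N`). -/
theorem stub_dyadicFrictionResponse : ∀ ω₂ lam β : ℝ, 0 < ω₂ → 0 < lam → 0 < β → ∀ T : ℝ, 0 < T → ∀ Φ : ℕ → ℝ → ℝ, (∀ N : ℕ, 2 ≤ N → Monotone (Φ N) ∧ (∀ s : ℝ, s ≤ 0 → Φ N s = 0) ∧ (∃ m : ℝ, ∀ s : ℝ, Φ N s ≤ m) ∧ ∀ γ : ℝ, 0 < γ → (∀ (N' : ℕ) (T_L T_R : ℝ), 0 < T_L → 0 < T_R → ∀ μ ν : MeasureTheory.Measure (Literature.MathematicalPhysics.KineticTheory.HeatConduction.PhaseSpace N'), (Literature.MathematicalPhysics.KineticTheory.HeatConduction.pinnedChain ω₂ lam β γ).IsSteadyState N' T_L T_R μ → (Literature.MathematicalPhysics.KineticTheory.HeatConduction.pinnedChain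 ω₂ lam β γ).IsSteadyState N' T_L T_R ν → μ = ν) → ∀ μ : (N' : ℕ) → ℝ → ℝ → MeasureTheory.Measure (Literature.MathematicalPhysics.KineticTheory.HeatConduction.PhaseSpace N'), (∀ (N' : ℕ) (T_L T_R : ℝ), 0 < T_L → 0 < T_R → (Literature.MathematicalPhysics.KineticTheory.HeatConduction.pinnedChain ω₂ lam β γ).IsSteadyState N' T_L T_R (μ N' T_L T_R)) → Filter.Tendsto (fun δ : ℝ => (Literature.MathematicalPhysics.KineticTheory.HeatConduction.pinnedChain ω₂ lam β γ).totalCurrent (μ N (T + δ / 2) (T - δ / 2)) / δ) (nhdsWithin 0 {(0 : ℝ)}ᶜ) (nhds (((N : ℝ) - 1) * γ * ∫ t in Set.Ioi (0 : ℝ), Φ N t * (2 * t / (γ ^ 2 + t ^ 2) ^ 2)))) → ∃ C' : ℝ, ∃ N₀ : ℕ, ∀ N : ℕ, N₀ ≤ N → ∀ k : ℕ, (2 : ℝ) ^ k ≤ (N : ℝ) → ((N : ℝ) - 1) * (2 : ℝ) ^ k * ∫ t in Set.Ioi (0 : ℝ), Φ N t * (2 * t / (((2 : ℝ) ^ k)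 ^ 2 + t ^ 2) ^ 2) ≤ C' := by
  sorry

/-- stub 2 — UV / N-UNIFORM TOTAL CONTACT MASS (same statement as line `birth`'s
`stub_uvUniformMass`; one proof serves both lines): for every representing family `Φ`,
`∃ m N₂, ∀ N ≥ N₂, ∀ s, Φ_N(s) ≤ m` — the total mass `Φ_N(∞) = lim_{γ→∞} γ·G_N(γ)` of the contact
measure is bounded uniformly in `N` (expected `≤ ½·E_{μ_T}[U″(q₀)+V″(q₁−q₀)]`, Gibbs integration by
parts: the `CouplingFreeCeiling` technology, support item stmt-AtomisticToContinuum-15180). -/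
theorem stub_uvUniformMass : ∀ ω₂ lam β : ℝ, 0 < ω₂ → 0 < lam → 0 < β → ∀ T : ℝ, 0 < T → ∀ Φ : ℕ → ℝ → ℝ, (∀ N : ℕ, 2 ≤ N → Monotone (Φ N) ∧ (∀ s : ℝ, s ≤ 0 → Φ N s = 0) ∧ (∃ m : ℝ, ∀ s : ℝ, Φ N s ≤ m) ∧ ∀ γ : ℝ, 0 < γ → (∀ (N' : ℕ) (T_L T_R : ℝ), 0 < T_L → 0 < T_R → ∀ μ ν : MeasureTheory.Measure (Literature.MathematicalPhysics.KineticTheory.HeatConduction.PhaseSpace N'), (Literature.MathematicalPhysics.KineticTheory.HeatConduction.pinnedChain ω₂ lam β γ).IsSteadyState N' T_L T_R μ → (Literature.MathematicalPhysics.KineticTheory.HeatConduction.pinnedChain ω₂ lam β γ).IsSteadyState N' T_L T_R ν → μ = ν) → ∀ μ : (N' : ℕ) → ℝ → ℝ → MeasureTheory.Measure (Literature.MathematicalPhysics.KineticTheory.HeatConduction.PhaseSpace N'), (∀ (N' : ℕ) (T_L T_R : ℝ), 0 < T_L → 0 < T_R → (Literature.MathematicalPhysics.KineticTheory.HeatConduction.pinnedChain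 ω₂ lam β γ).IsSteadyState N' T_L T_R (μ N' T_L T_R)) → Filter.Tendsto (fun δ : ℝ => (Literature.MathematicalPhysics.KineticTheory.HeatConduction.pinnedChain ω₂ lam β γ).totalCurrent (μ N (T + δ / 2) (T - δ / 2)) / δ) (nhdsWithin 0 {(0 : ℝ)}ᶜ) (nhds (((N : ℝ) - 1) * γ * ∫ t in Set.Ioi (0 : ℝ), Φ N t * (2 * t / (γ ^ 2 + t ^ 2) ^ 2)))) → ∃ m : ℝ, ∃ N₂ : ℕ, ∀ N : ℕ, N₂ ≤ N → ∀ s : ℝ, Φ N s ≤ m := by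
  sorry

/-! ## Assembly (sorry-free) -/

/-- ASSEMBLY LOGIC (kernel-checked, sorry-free): the two stub statements imply the crux body.
For `N ≥ max N₀ N₂ 2`, with `A = max C' 0`, `M = max m 0`: each grid level `k` with `2^k ≤ N`
gives `N·Φ_N(2^k) ≤ 4A·2^k` (sandwich + `level_bound`); for `t ≤ 1` use `k = 0` and monotonicity;
for `t > 1` pick `2^j ≤ t < 2^(j+1)` (`exists_nat_pow_near`): if `2^(j+1) ≤ N` use level `j+1`
(`≤ 8A·t`), else `N < 2^(j+1) ≤ 2t` and the UV stub gives `N·Φ_N(t) ≤ N·M ≤ 2M·t`.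
Constant `C = 8A + 2M`. -/
theorem assembly_of_stubs
    (hGrid : ∀ ω₂ lam β : ℝ, 0 < ω₂ → 0 < lam → 0 < β → ∀ T : ℝ, 0 < T → ∀ Φ : ℕ → ℝ → ℝ, (∀ N : ℕ, 2 ≤ N → Monotone (Φ N) ∧ (∀ s : ℝ, s ≤ 0 → Φ N s = 0) ∧ (∃ m : ℝ, ∀ s : ℝ, Φ N s ≤ m) ∧ ∀ γ : ℝ, 0 < γ → (∀ (N' : ℕ) (T_L T_R : ℝ), 0 < T_L → 0 < T_R → ∀ μ ν : MeasureTheory.Measure (Literature.MathematicalPhysics.KineticTheory.HeatConduction.PhaseSpace N'), (Literature.MathematicalPhysics.KineticTheory.HeatConduction.pinnedChain ω₂ lam β γ).IsSteadyState N' T_L T_R μ → (Literature.MathematicalPhysics.KineticTheory.HeatConduction.pinnedChain ω₂ lam β γ).IsSteadyState N' T_L T_R ν → μ = ν) → ∀ μ : (N' : ℕ) → ℝ → ℝ → MeasureTheory.Measure (Literature.MathematicalPhysics.KineticTheory.HeatConduction.PhaseSpace N'), (∀ (N' : ℕ) (T_L T_R : ℝ), 0 < T_L → 0 < T_R → (Literature.MathematicalPhysics.KineticTheory.HeatConduction.pinnedChain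 ω₂ lam β γ).IsSteadyState N' T_L T_R (μ N' T_L T_R)) → Filter.Tendsto (fun δ : ℝ => (Literature.MathematicalPhysics.KineticTheory.HeatConduction.pinnedChain ω₂ lam β γ).totalCurrent (μ N (T + δ / 2) (T - δ / 2)) / δ) (nhdsWithin 0 {(0 : ℝ)}ᶜ) (nhds (((N : ℝ) - 1) * γ * ∫ t in Set.Ioi (0 : ℝ), Φ N t * (2 * t / (γ ^ 2 + t ^ 2) ^ 2)))) → ∃ C' : ℝ, ∃ N₀ : ℕ, ∀ N : ℕ, N₀ ≤ N → ∀ k : ℕ, (2 : ℝ) ^ k ≤ (N : ℝ) → ((N : ℝ) - 1) * (2 : ℝ) ^ k * ∫ t in Set.Ioi (0 : ℝ), Φ N t * (2 * t / (((2 : ℝ) ^ k) ^ 2 + t ^ 2) ^ 2) ≤ C')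
    (hUV : ∀ ω₂ lam β : ℝ, 0 < ω₂ → 0 < lam → 0 < β → ∀ T : ℝ, 0 < T → ∀ Φ : ℕ → ℝ → ℝ, (∀ N : ℕ, 2 ≤ N → Monotone (Φ N) ∧ (∀ s : ℝ, s ≤ 0 → Φ N s = 0) ∧ (∃ m : ℝ, ∀ s : ℝ, Φ N s ≤ m) ∧ ∀ γ : ℝ, 0 < γ → (∀ (N' : ℕ) (T_L T_R : ℝ), 0 < T_L → 0 < T_R → ∀ μ ν : MeasureTheory.Measure (Literature.MathematicalPhysics.KineticTheory.HeatConduction.PhaseSpace N'), (Literature.MathematicalPhysics.KineticTheory.HeatConduction.pinnedChain ω₂ lam β γ).IsSteadyState N' T_L T_R μ → (Literature.MathematicalPhysics.KineticTheory.HeatConduction.pinnedChain ω₂ lam β γ).IsSteadyState N' T_L T_R ν → μ = ν) → ∀ μ : (N' : ℕ) → ℝ → ℝ → MeasureTheory.Measure (Literature.MathematicalPhysics.KineticTheory.HeatConduction.PhaseSpace N'), (∀ (N' : ℕ) (T_L T_R : ℝ), 0 < T_L → 0 < T_R → (Literature.MathematicalPhysics.KineticTheory.HeatConduction.pinnedChain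 ω₂ lam β γ).IsSteadyState N' T_L T_R (μ N' T_L T_R)) → Filter.Tendsto (fun δ : ℝ => (Literature.MathematicalPhysics.KineticTheory.HeatConduction.pinnedChain ω₂ lam β γ).totalCurrent (μ N (T + δ / 2) (T - δ / 2)) / δ) (nhdsWithin 0 {(0 : ℝ)}ᶜ) (nhds (((N : ℝ) - 1) * γ * ∫ t in Set.Ioi (0 : ℝ), Φ N t * (2 * t / (γ ^ 2 + t ^ 2) ^ 2)))) → ∃ m : ℝ, ∃ N₂ : ℕ, ∀ N : ℕ, N₂ ≤ N → ∀ s : ℝ, Φ N s ≤ m) :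
    ∀ ω₂ lam β : ℝ, 0 < ω₂ → 0 < lam → 0 < β → ∀ T : ℝ, 0 < T → ∀ Φ : ℕ → ℝ → ℝ, (∀ N : ℕ, 2 ≤ N → Monotone (Φ N) ∧ (∀ s : ℝ, s ≤ 0 → Φ N s = 0) ∧ (∃ m : ℝ, ∀ s : ℝ, Φ N s ≤ m) ∧ ∀ γ : ℝ, 0 < γ → (∀ (N' : ℕ) (T_L T_R : ℝ), 0 < T_L → 0 < T_R → ∀ μ ν : MeasureTheory.Measure (Literature.MathematicalPhysics.KineticTheory.HeatConduction.PhaseSpace N'), (Literature.MathematicalPhysics.KineticTheory.HeatConduction.pinnedChain ω₂ lam β γ).IsSteadyState N' T_L T_R μ → (Literature.MathematicalPhysics.KineticTheory.HeatConduction.pinnedChain ω₂ lam β γ).IsSteadyState N' T_L T_R ν → μ = ν) → ∀ μ : (N' : ℕ) → ℝ → ℝ → MeasureTheory.Measure (Literature.MathematicalPhysics.KineticTheory.HeatConduction.PhaseSpace N'), (∀ (N' : ℕ) (T_L T_R : ℝ), 0 < T_L → 0 < T_R → (Literature.MathematicalPhysics.KineticTheory.HeatConduction.pinnedChain ω₂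 lam β γ).IsSteadyState N' T_L T_R (μ N' T_L T_R)) → Filter.Tendsto (fun δ : ℝ => (Literature.MathematicalPhysics.KineticTheory.HeatConduction.pinnedChain ω₂ lam β γ).totalCurrent (μ N (T + δ / 2) (T - δ / 2)) / δ) (nhdsWithin 0 {(0 : ℝ)}ᶜ) (nhds (((N : ℝ) - 1) * γ * ∫ t in Set.Ioi (0 : ℝ), Φ N t * (2 * t / (γ ^ 2 + t ^ 2) ^ 2)))) → ∃ C : ℝ, ∃ N₀ : ℕ, ∀ N : ℕ, N₀ ≤ N → ∀ t : ℝ, 0 < t → (N : ℝ) * Φ N t ≤ C * (1 + t) := by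
  intro ω₂ lam β hω hl hβ T hT Φ hΦ
  obtain ⟨C', N₀, hC'⟩ := hGrid ω₂ lam β hω hl hβ T hT Φ hΦ
  obtain ⟨m, N₂, hm⟩ := hUV ω₂ lam β hω hl hβ T hT Φ hΦ
  obtain ⟨A, hA0, hC'A⟩ : ∃ A : ℝ, 0 ≤ A ∧ C' ≤ A := ⟨max C' 0, le_max_right _ _, le_max_left _ _⟩
  obtain ⟨M, hM0, hmM⟩ : ∃ M : ℝ, 0 ≤ M ∧ m ≤ M := ⟨max m 0, le_max_right _ _, le_max_left _ _⟩
  refine ⟨8 * A + 2 * M, max (max N₀ N₂) 2, ?_⟩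
  intro N hN t ht
  have hN₀ : N₀ ≤ N := le_trans (le_max_left _ _) (le_trans (le_max_left _ _) hN)
  have hN₂ : N₂ ≤ N := le_trans (le_max_right _ _) (le_trans (le_max_left _ _) hN)
  have h2N : 2 ≤ N := le_trans (le_max_right _ _) hN
  have h2Nr : (2 : ℝ) ≤ (N : ℝ) := by exact_mod_cast h2N
  have hNpos : (0 : ℝ) ≤ (N : ℝ) := Nat.cast_nonneg N
  obtain ⟨hmono, hzero, ⟨mN, hmN⟩, -⟩ := hΦ N h2N
  have hΦnn : ∀ s : ℝ, 0 ≤ s → 0 ≤ Φ N s := fun s hs => by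
    have h := hmono hs
    rwa [hzero 0 le_rfl] at h
  -- one grid level: N * Φ N (2^k) ≤ 4 * A * 2^k whenever 2^k ≤ N
  have grid : ∀ k : ℕ, (2 : ℝ) ^ k ≤ (N : ℝ) → (N : ℝ) * Φ N ((2 : ℝ) ^ k) ≤ 4 * A * (2 : ℝ) ^ k := by
    intro k hk
    have hg : (0 : ℝ) < (2 : ℝ) ^ k := by positivity
    have hI0 : 0 ≤ ∫ t in Set.Ioi (0 : ℝ), Φ N t * (2 * t / (((2 : ℝ) ^ k) ^ 2 + t ^ 2) ^ 2) :=
      setIntegral_nonneg measurableSet_Ioi fun t ht =>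
        mul_nonneg (hΦnn t (Set.mem_Ioi.1 ht).le) (weight_nonneg (Set.mem_Ioi.1 ht).le)
    exact level_bound h2Nr hg hI0 ((hC' N hN₀ k hk).trans hC'A) (sandwich hmono hzero hmN hg)
  by_cases ht1 : t ≤ 1
  · -- scales t ≤ 1: the unit friction (k = 0) and monotonicity
    have h0 : (2 : ℝ) ^ (0 : ℕ) ≤ (N : ℝ) := by rw [pow_zero]; linarith
    have hg0 := grid 0 h0
    rw [pow_zero] at hg0
    calc (N : ℝ) * Φ N t ≤ (N : ℝ) * Φ N 1 := mul_le_mul_of_nonneg_left (hmono ht1) hNpos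
      _ ≤ 4 * A * 1 := hg0
      _ ≤ (8 * A + 2 * M) * (1 + t) := by nlinarith [hA0, hM0, ht]
  · have ht1' : (1 : ℝ) < t := lt_of_not_ge ht1
    obtain ⟨j, hj1, hj2⟩ := exists_nat_pow_near ht1'.le (by norm_num : (1 : ℝ) < 2)
    have hsucc : (2 : ℝ) ^ (j + 1) = 2 * (2 : ℝ) ^ j := by rw [pow_succ]; ring
    by_cases hjN : (2 : ℝ) ^ (j + 1) ≤ (N : ℝ)
    · -- bulk scales: the grid friction 2^(j+1) ≤ N just above t
      have hg := grid (j + 1) hjN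
      calc (N : ℝ) * Φ N t ≤ (N : ℝ) * Φ N ((2 : ℝ) ^ (j + 1)) :=
            mul_le_mul_of_nonneg_left (hmono hj2.le) hNpos
        _ ≤ 4 * A * (2 : ℝ) ^ (j + 1) := hg
        _ = 8 * A * (2 : ℝ) ^ j := by rw [hsucc]; ring
        _ ≤ 8 * A * t := mul_le_mul_of_nonneg_left hj1 (by positivity)
        _ ≤ (8 * A + 2 * M) * (1 + t) := by nlinarith [hA0, hM0, ht]
    · -- UV scales: N < 2^(j+1) ≤ 2t, total mass bound
      have hjN' : (N : ℝ) < (2 : ℝ) ^ (j + 1) := lt_of_not_ge hjN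
      have hNt : (N : ℝ) ≤ 2 * t := by rw [hsucc] at hjN'; linarith
      have hΦM : Φ N t ≤ M := (hm N hN₂ t).trans hmM
      calc (N : ℝ) * Φ N t ≤ (N : ℝ) * M := mul_le_mul_of_nonneg_left hΦM hNpos
        _ ≤ 2 * t * M := mul_le_mul_of_nonneg_right hNt hM0
        _ ≤ (8 * A + 2 * M) * (1 + t) := by nlinarith [hA0, hM0, ht]

/-- THE SKELETON THEOREM: concludes the crux `Theses.ContactStieltjesMeasure.ContactUpperDensity`
BY NAME, no hypotheses, no `sorry` of its own — its only non-whitelisted dependencies are the two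
DECLARED stubs, fed by name into the sorry-free `assembly_of_stubs`. -/
theorem ContactUpperDensity_of :
    Summit.AtomisticToContinuum.FouriersLaw.Theses.ContactStieltjesMeasure.ContactUpperDensity :=
  assembly_of_stubs stub_dyadicFrictionResponse stub_uvUniformMass

end Summit.AtomisticToContinuum.FouriersLaw.Cruxes.ContactUpperDensity.FrictionGrid
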